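import Literature.Topology.FourManifolds.StableRangeFramePeel
import Literature.Topology.FourManifolds.ImmersedFramePullback
import Mathlib.Analysis.InnerProductSpace.Dual
import HarnessLib

/-!
# A regular level in Euclidean space is stably framed along any compact manifold of its dimension

Topic `Literature/Topology/FourManifolds`; the framing step of Kervaire–Milnor's Lemma 4.2 `⇒`
(*Groups of homotopy spheres I*, Ann. of Math. 77 (1963), p. 510: the bounding manifold
`W = G⁻¹(y) ⊆ ℝᴺ` produced by transversality carries *"a field `ψ` of normal frames"* — the
gradients of `G` — and *"It follows from Lemmas 3.3 and 3.4 that `W` is parallelizable"*; the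
Lemma 3.3 half, `TW ⊕ ℝᵏ ≅ ℝᴺ ⇒ TW ⊕ ℝ ≅ ℝⁿ⁺²`, is Lemma 3.5 applied `k - 1` times, p. 509).

Let `Z` be the level `G⁻¹(y)` of a map `G : ℝᴺ ⊇ O → ℝᵏ` with onto differential along it,
presented as in `RegularValuePreimage.lean` by a `C^∞` embedding `e : Z → ℝᴺ` of an `m`-manifold
(`N = m + k`) with `range de_z = ker dG_{e z}`, and let `φ : S → Z` be continuous from a compact
`C^∞` manifold `S` of dimension `m` (any model with corners; in Lemma 4.2, `S = W = Z ∩ {‖p‖ ≥ 1}`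
with its structure of manifold with boundary and `φ` the inclusion).  Then `TZ ⊕ ℝ` is framed
along `φ` (`Literature.Topology.FourManifolds.hasStableTangentFramingAlong_of_regularPreimage`,
in the sense of `Literature.Topology.FourManifolds.HasStableTangentFramingAlong`, `Spin.lean`).

Proof.  Over `S` the ambient space splits as `ℝᴺ = K ⊕ span (∇G₁, …, ∇G_k)`, `K = ker dG = de(TZ)`,
the gradients `νᵢ(s) = ∇Gᵢ(e φ s)` being continuous and — `dG` being onto — independent.  Starting
from the constant frame of `ℝᴺ = Kᵏ` one peels off the gradient directions one at a time
(`Literature.Topology.FourManifolds.exists_frame_perp_of_finrank_lt`, `StableRangeFramePeel.lean`;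
the hypothesis that the next gradient is not orthogonal to the current frame, and the bookkeeping
of which gradients annihilate which frame, are the dimension count
`Literature.Topology.FourManifolds.not_linearIndependent_of_apply_eq_zero`), as long as the rank
`m + j` of `Kʲ = {ξ | ⟪νᵢ, ξ⟫ = 0, i < k - j}` exceeds `dim S = m`, i.e. down to a frame
`F₀, …, F_m` of `K¹ ⊋ K`.  The last direction is split off linearly: with `aₐ = ⟪Fₐ, ν_{k-1}⟫`
(not all zero) and `q = Σ aₐ Fₐ` (`⟪q, ν_{k-1}⟫ = ‖a‖² > 0`), the pairs
`(Fₐ - (aₐ/‖a‖²) q, aₐ) ∈ K × ℝ` are independent, and tangent ambient fields with a real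
component are a stable framing along `φ`
(`Literature.Topology.FourManifolds.hasStableTangentFramingAlong_of_ambient_frame`,
`ImmersedFramePullback.lean`).

Everything here is proved; no definitions, no named facts.

## References

* M. Kervaire, J. Milnor, *Groups of homotopy spheres I*, Ann. of Math. (2) 77 (1963), 504–537,
  Lemmas 3.3–3.5 (p. 509), proof of Lemma 4.2 (p. 510). doi:10.2307/1970128
  [KervaireMilnorAnnals1963]
-/

open scoped Manifold ContDiff Topology RealInnerProductSpace
open Set Function Module

noncomputable section

namespace Literature.Topology.FourManifolds

/-! ### Linear algebra: the dimension count of the peeling -/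

section LinearAlgebra

variable {V : Type*} [NormedAddCommGroup V] [InnerProductSpace ℝ V] [FiniteDimensional ℝ V]

/-- **Restriction to the first `c` coordinates** `ℝᵏ → ℝᶜ` is onto. [folklore] -/
theorem surjective_restrictFirst {kk c : ℕ} (hc : c ≤ kk) :
    Surjective (fun v : EuclideanSpace ℝ (Fin kk) ↦ fun i : Fin c ↦ v (Fin.castLE hc i)) := by
  classical
  intro w
  refine ⟨WithLp.toLp 2 fun i : Fin kk ↦ if h : (i : ℕ) < c then w ⟨i, h⟩ else 0, ?_⟩
  funext i
  simp [Fin.val_castLE]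

/-- **The dimension count of the peeling.**  If `D : V → ℝᵏ` is an onto linear map and `r`
vectors `Fₐ` are annihilated by the first `c ≤ k` coordinates of `D`, they cannot be linearly
independent once `r + c > dim V` (they lie in the kernel of the onto map
`(D·)_{i < c} : V → ℝᶜ`, of dimension `dim V - c`).  In Kervaire–Milnor's Lemma 3.5 / proof of
Lemma 4.2 this is why the next gradient is never orthogonal to the current frame, and why the final
frame has a component along the last gradient.
[cite: KervaireMilnorAnnals1963, Lemma 3.5 (p. 509)] -/
theorem not_linearIndependent_of_apply_eq_zero {kk c r : ℕ} (D : V →ₗ[ℝ] EuclideanSpace ℝ (Fin kk))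
    (hD : Surjective D) (hc : c ≤ kk) (F : Fin r → V)
    (hann : ∀ a (i : Fin kk), (i : ℕ) < c → D (F a) i = 0) (hr : finrank ℝ V < r + c) :
    ¬ LinearIndependent ℝ F := by
  classical
  intro hF
  -- the onto map `L = (D·)_{i < c}` and its kernel
  let R : EuclideanSpace ℝ (Fin kk) →ₗ[ℝ] (Fin c → ℝ) :=
    { toFun := fun v i ↦ v (Fin.castLE hc i)
      map_add' := fun v w ↦ by funext i; rfl
      map_smul' := fun t v ↦ by funext i; rfl }
  let L : V →ₗ[ℝ] (Fin c → ℝ) := R ∘ₗ D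
  have hL : Surjective L := (surjective_restrictFirst hc).comp hD
  have hker : finrank ℝ (LinearMap.ker L) + c = finrank ℝ V := by
    have h1 := LinearMap.finrank_range_add_finrank_ker L
    rw [LinearMap.range_eq_top.2 hL, finrank_top, Module.finrank_fintype_fun_eq_card,
      Fintype.card_fin] at h1
    omega
  -- `span F ≤ ker L` has dimension `r`
  have hle : Submodule.span ℝ (Set.range F) ≤ LinearMap.ker L := by
    rw [Submodule.span_le]
    rintro _ ⟨a, rfl⟩
    simp only [SetLike.mem_coe, LinearMap.mem_ker]
    funext i
    exact hann a _ (by simp)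
  have hspan : finrank ℝ (Submodule.span ℝ (Set.range F)) = r := by
    rw [finrank_span_eq_card hF, Fintype.card_fin]
  have := Submodule.finrank_mono hle
  omega

end LinearAlgebra

/-! ### The stable framing of a regular level along a compact manifold -/

section Framing

variable {ES HS : Type*} [NormedAddCommGroup ES] [NormedSpace ℝ ES] [FiniteDimensional ℝ ES]
  [TopologicalSpace HS] (IS : ModelWithCorners ℝ ES HS)
  {S : Type*} [TopologicalSpace S] [ChartedSpace HS S] [IsManifold IS ∞ S]
  [CompactSpace S] [T2Space S] [SecondCountableTopology S]
  {N kk m : ℕ} {Z : Type*} [TopologicalSpace Z] [ChartedSpace (EuclideanSpace ℝ (Fin m)) Z]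
  [IsManifold (𝓡 m) ∞ Z]

include IS in
/-- **A regular level is stably framed along any compact manifold of its dimension**
(Kervaire–Milnor 1963, proof of Lemma 4.2 with Lemmas 3.3, 3.5: the gradient frame of the
normal bundle of `W = G⁻¹(y) ⊆ ℝᴺ` is peeled off down to one direction).  Hypotheses: `G` is
`C^∞` on an open `O ⊆ ℝᴺ`, `N = m + k`, `k ≥ 1`; `e : Z → O` is a `C^∞` embedding of an
`m`-manifold without boundary with `range de_z = ker dG_{e z}` (`RegularValuePreimage.lean`) and
`dG_{e z}` onto; `φ : S → Z` is continuous on a compact `C^∞` manifold `S` (any model with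
corners) of dimension `m`.  Conclusion: `TZ ⊕ ℝ` is framed along `φ`.
[cite: KervaireMilnorAnnals1963, Lemmas 3.3–3.5 (p. 509) and proof of Lemma 4.2 (p. 510)] -/
theorem hasStableTangentFramingAlong_of_regularPreimage (hN : N = m + kk) (hk : 1 ≤ kk)
    (hdim : finrank ℝ ES = m)
    {O : Set (EuclideanSpace ℝ (Fin N))} (hO : IsOpen O)
    {G : EuclideanSpace ℝ (Fin N) → EuclideanSpace ℝ (Fin kk)} (hG : ContDiffOn ℝ ∞ G O)
    {e : Z → EuclideanSpace ℝ (Fin N)} (he : Manifold.IsSmoothEmbedding (𝓡 m) (𝓡 N) ∞ e)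
    (heO : ∀ z, e z ∈ O)
    (hte : ∀ (z : Z) (ξ : EuclideanSpace ℝ (Fin N)), fderiv ℝ G (e z) ξ = 0 ↔
      ∃ u : EuclideanSpace ℝ (Fin m), mfderiv (𝓡 m) (𝓡 N) e z u = ξ)
    (hsurj : ∀ z, Surjective (fderiv ℝ G (e z)))
    {φ : S → Z} (hφ : Continuous φ) : HasStableTangentFramingAlong (𝓡 m) Z φ := by
  classical
  -- the differential along `e ∘ φ` and the gradients `ν i s`
  set D : S → (EuclideanSpace ℝ (Fin N) →L[ℝ] EuclideanSpace ℝ (Fin kk)) :=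
    fun s ↦ fderiv ℝ G (e (φ s)) with hD
  have heφ : Continuous fun s ↦ e (φ s) := he.contMDiff.continuous.comp hφ
  have hDc : Continuous D :=
    (hG.continuousOn_fderiv_of_isOpen hO (by exact_mod_cast le_top)).comp_continuous heφ
      fun s ↦ heO _
  set ν : Fin kk → S → EuclideanSpace ℝ (Fin N) := fun i s ↦
    (InnerProductSpace.toDual ℝ (EuclideanSpace ℝ (Fin N))).symm
      ((EuclideanSpace.proj i).comp (D s)) with hν
  have hν_inner : ∀ i s (ξ : EuclideanSpace ℝ (Fin N)), ⟪ν i s, ξ⟫ = D s ξ i := fun i s ξ ↦ by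
    rw [hν]
    simp only [InnerProductSpace.toDual_symm_apply]
    rfl
  have hνc : ∀ i, Continuous (ν i) := fun i ↦
    (InnerProductSpace.toDual ℝ (EuclideanSpace ℝ (Fin N))).symm.continuous.comp
      (((ContinuousLinearMap.compL ℝ (EuclideanSpace ℝ (Fin N)) (EuclideanSpace ℝ (Fin kk)) ℝ)
        (EuclideanSpace.proj i)).continuous.comp hDc)
  -- the dimension count, in the form used twice below
  have hcount : ∀ (j : ℕ) (s : S) (F : Fin (m + j + 1) → EuclideanSpace ℝ (Fin N)), j + 1 ≤ kk →
      LinearIndependent ℝ F → (∀ a (i : Fin kk), (i : ℕ) < kk - j - 1 → ⟪ν i s, F a⟫ = 0) →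
      ∃ a, ⟪F a, ν ⟨kk - j - 1, by omega⟩ s⟫ ≠ 0 := by
    intro j s F hj hF hann
    by_contra hcon
    push Not at hcon
    refine not_linearIndependent_of_apply_eq_zero
      (D s : EuclideanSpace ℝ (Fin N) →ₗ[ℝ] EuclideanSpace ℝ (Fin kk))
      (fun v ↦ hsurj (φ s) v) (c := kk - j) (by omega) F (fun a i hi ↦ ?_) ?_ hF
    · rw [ContinuousLinearMap.coe_coe, ← hν_inner]
      rcases Nat.lt_or_ge (i : ℕ) (kk - j - 1) with h | h
      · exact hann a i h
      · have : i = ⟨kk - j - 1, by omega⟩ := Fin.ext (by simp; omega)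
        rw [this, real_inner_comm]
        exact hcon a
    · rw [finrank_euclideanSpace_fin]; omega
  -- peeling: frames of `Kʲ = {ξ | ⟪ν i, ξ⟫ = 0 for i < kk - j}`, `j = kk, kk - 1, …, 1`
  have hpeel : ∀ j : ℕ, 1 ≤ j → j ≤ kk → ∃ F : Fin (m + j) → S → EuclideanSpace ℝ (Fin N),
      (∀ a, Continuous (F a)) ∧ (∀ s, LinearIndependent ℝ fun a ↦ F a s) ∧
      ∀ a s (i : Fin kk), (i : ℕ) < kk - j → ⟪ν i s, F a s⟫ = 0 := by
    -- downward induction on `j`, written as induction on `t = kk - j`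
    suffices h : ∀ t : ℕ, t + 1 ≤ kk → ∃ F : Fin (m + (kk - t)) → S → EuclideanSpace ℝ (Fin N),
        (∀ a, Continuous (F a)) ∧ (∀ s, LinearIndependent ℝ fun a ↦ F a s) ∧
        ∀ a s (i : Fin kk), (i : ℕ) < t → ⟪ν i s, F a s⟫ = 0 by
      intro j hj1 hjk
      have h' := h (kk - j) (by omega)
      have hkj : kk - (kk - j) = j := by omega
      rw [hkj] at h'
      exact h'
    intro t
    induction t with
    | zero =>
      intro _
      -- the constant standard frame of `ℝᴺ`, `N = m + kk`
      have hcast : m + (kk - 0) = N := by omega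
      refine ⟨fun a _ ↦ PiLp.basisFun 2 ℝ (Fin N) (finCongr hcast a),
        fun a ↦ continuous_const, fun s ↦ ?_, fun a s i hi ↦ absurd hi (Nat.not_lt_zero _)⟩
      exact (PiLp.basisFun 2 ℝ (Fin N)).linearIndependent.comp _ (finCongr hcast).injective
    | succ t ih =>
      intro ht
      obtain ⟨F, hFc, hFli, hFann⟩ := ih (by omega)
      -- peel off the direction `ν t`
      have hr : finrank ℝ ES < m + (kk - (t + 1)) := by rw [hdim]; omega
      have hsz : m + (kk - t) = m + (kk - (t + 1)) + 1 := by omega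
      set F' : Fin (m + (kk - (t + 1)) + 1) → S → EuclideanSpace ℝ (Fin N) :=
        fun a ↦ F (finCongr hsz.symm a)
        with hF'
      have hF'c : ∀ a, Continuous (F' a) := fun a ↦ hFc _
      have hF'li : ∀ s, LinearIndependent ℝ fun a ↦ F' a s := fun s ↦
        (hFli s).comp _ (finCongr hsz.symm).injective
      have hF'ann : ∀ a s (i : Fin kk), (i : ℕ) < t → ⟪ν i s, F' a s⟫ = 0 := fun a s i hi ↦
        hFann _ s i hi
      have hνF : ∀ s, ∃ a, ⟪F' a s, ν ⟨t, by omega⟩ s⟫ ≠ 0 := by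
        intro s
        have h := hcount (kk - (t + 1)) s (fun a ↦ F' a s) (by omega) (hF'li s)
          (fun a i hi ↦ hF'ann a s i (by omega))
        have hidx : (⟨kk - (kk - (t + 1)) - 1, by omega⟩ : Fin kk) = ⟨t, by omega⟩ :=
          Fin.ext (by simp; omega)
        rwa [hidx] at h
      obtain ⟨T, hTc, hTli, hTspan, hTperp⟩ :=
        exists_frame_perp_of_finrank_lt IS hr hF'c hF'li (hνc ⟨t, by omega⟩) hνF
      refine ⟨T, hTc, hTli, fun a s i hi ↦ ?_⟩
      rcases Nat.lt_or_ge (i : ℕ) t with h | h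
      · -- annihilated because `T a s ∈ span (F' · s) ⊆ (ν i s)ᗮ`
        have hsub : Submodule.span ℝ (Set.range fun b ↦ F' b s) ≤
            LinearMap.ker ((innerSL ℝ (ν i s) : EuclideanSpace ℝ (Fin N) →L[ℝ] ℝ) :
              EuclideanSpace ℝ (Fin N) →ₗ[ℝ] ℝ) := by
          rw [Submodule.span_le]
          rintro _ ⟨b, rfl⟩
          simp only [SetLike.mem_coe, LinearMap.mem_ker, ContinuousLinearMap.coe_coe,
            innerSL_apply_apply]
          exact hF'ann b s i h
        have := hsub (hTspan a s)
        simpa only [LinearMap.mem_ker, ContinuousLinearMap.coe_coe, innerSL_apply_apply] using this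
      · have : i = ⟨t, by omega⟩ := Fin.ext (by simp; omega)
        rw [this, real_inner_comm]
        exact hTperp a s
  -- the frame of `K¹` and the linear splitting of the last direction `ν (kk - 1)`
  obtain ⟨F, hFc, hFli, hFann⟩ := hpeel 1 le_rfl hk
  set ν₀ : S → EuclideanSpace ℝ (Fin N) := ν ⟨kk - 1, by omega⟩ with hν₀
  set a : Fin (m + 1) → S → ℝ := fun b s ↦ ⟪F b s, ν₀ s⟫ with ha
  have hac : ∀ b, Continuous (a b) := fun b ↦ (hFc b).inner (hνc _)
  set Asq : S → ℝ := fun s ↦ ∑ b, a b s ^ 2 with hAsq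
  have hAsqc : Continuous Asq := continuous_finsetSum _ fun b _ ↦ (hac b).pow 2
  have hAsq_pos : ∀ s, 0 < Asq s := by
    intro s
    obtain ⟨b, hb⟩ := hcount 0 s (fun b ↦ F b s) (by omega) (hFli s)
      (fun b i hi ↦ hFann b s i (by omega))
    have hb' : a b s ≠ 0 := hb
    exact Finset.sum_pos' (fun c _ ↦ sq_nonneg _) ⟨b, Finset.mem_univ _, by positivity⟩
  set q : S → EuclideanSpace ℝ (Fin N) := fun s ↦ ∑ b, a b s • F b s with hq
  have hqc : Continuous q := continuous_finsetSum _ fun b _ ↦ (hac b).smul (hFc b)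
  have hqν : ∀ s, ⟪q s, ν₀ s⟫ = Asq s := fun s ↦ by
    rw [hq, hAsq]
    simp only [sum_inner, real_inner_smul_left]
    refine Finset.sum_congr rfl fun b _ ↦ ?_
    show a b s * a b s = a b s ^ 2
    ring
  set κ : Fin (m + 1) → S → EuclideanSpace ℝ (Fin N) := fun b s ↦ F b s - (a b s / Asq s) • q s
    with hκ
  have hκc : ∀ b, Continuous (κ b) := fun b ↦
    (hFc b).sub (((hac b).div hAsqc fun s ↦ (hAsq_pos s).ne').smul hqc)
  -- `κ b s` is tangent: all gradients annihilate it
  have hκν : ∀ b s (i : Fin kk), ⟪ν i s, κ b s⟫ = 0 := by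
    intro b s i
    rw [hκ]
    simp only [inner_sub_right, inner_smul_right]
    rcases Nat.lt_or_ge (i : ℕ) (kk - 1) with h | h
    · rw [hFann b s i h]
      have : ⟪ν i s, q s⟫ = 0 := by
        rw [hq, inner_sum]
        refine Finset.sum_eq_zero fun c _ ↦ ?_
        rw [inner_smul_right, hFann c s i h, mul_zero]
      rw [this, mul_zero, sub_zero]
    · have hi : i = ⟨kk - 1, by omega⟩ := Fin.ext (by simp; omega)
      rw [hi, ← real_inner_comm (ν₀ s) (q s), hqν, div_mul_cancel₀ _ (hAsq_pos s).ne',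
        sub_eq_zero]
      exact real_inner_comm (F b s) (ν₀ s)
  have hκtan : ∀ b s, ∃ u : EuclideanSpace ℝ (Fin m), mfderiv (𝓡 m) (𝓡 N) e (φ s) u = κ b s := by
    intro b s
    refine (hte (φ s) (κ b s)).1 ?_
    ext i
    rw [← hν_inner]
    simpa using hκν b s i
  -- the stable frame `(κ b, a b)` and its reindexing to `Fin (finrank ℝ ℝᵐ + 1)`
  have hcast : finrank ℝ (EuclideanSpace ℝ (Fin m)) + 1 = m + 1 := by
    rw [finrank_euclideanSpace_fin]
  set w : Fin (finrank ℝ (EuclideanSpace ℝ (Fin m)) + 1) → S → EuclideanSpace ℝ (Fin N) × ℝ :=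
    fun b s ↦ (κ (finCongr hcast b) s, a (finCongr hcast b) s) with hw
  refine hasStableTangentFramingAlong_of_ambient_frame he.isImmersion hφ (w := w)
    (fun b ↦ (hκc _).prodMk (hac _)) (fun b s ↦ hκtan _ s) fun s ↦ ?_
  -- linear independence of the pairs
  have hli : LinearIndependent ℝ fun b : Fin (m + 1) ↦ (κ b s, a b s) := by
    rw [Fintype.linearIndependent_iff]
    intro μ hμ
    have h1 : ∑ b, μ b * a b s = 0 := by
      have := congrArg Prod.snd hμ
      simpa [Prod.snd_sum, smul_eq_mul] using this
    have h2 : ∑ b, μ b • κ b s = 0 := by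
      have := congrArg Prod.fst hμ
      simpa [Prod.fst_sum] using this
    -- hence `Σ μ_b F_b = Σ μ_b κ_b + (Σ μ_b a_b / A) q = 0`
    have h3 : ∑ b, μ b • F b s = 0 := by
      have hF : ∀ b, F b s = κ b s + (a b s / Asq s) • q s := fun b ↦ by
        rw [hκ]; simp only; abel
      simp_rw [hF, smul_add, Finset.sum_add_distrib, h2, zero_add, smul_smul]
      rw [← Finset.sum_smul]
      have : ∑ b, μ b * (a b s / Asq s) = (∑ b, μ b * a b s) / Asq s := by
        rw [Finset.sum_div]
        refine Finset.sum_congr rfl fun b _ ↦ ?_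
        ring
      rw [this, h1, zero_div, zero_smul]
    exact Fintype.linearIndependent_iff.1 (hFli s) μ h3
  exact hli.comp _ (finCongr hcast).injective

end Framing

end Literature.Topology.FourManifolds

end
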